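import Mathlib.Analysis.Calculus.Deriv.MeanValue
import Literature.MathematicalPhysics.QuantumFieldTheory.Balaban1983to89.T4ShellMeasure
import Summits.QuantumFields.YangMills.Theorems.BalabanUVNodesN21GaussianSupDensityBound

/-!
# N21 (NE7c) · the density bound for the maximum of INDEPENDENT centred Gaussians with HETEROGENEOUS variances

R134 seat pub-ymgap-dag-n21-d (g7), node N21 = NE7c (single-run shell-weight bound, NOT PRINTED in [Bałaban 1983–89],
NOT proved), lane K3⁶ `SpineGivenEndpointR13SepCoPR` (stmt-QuantumFields-20509, `--kind proof --supports … --as helper`).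
Part 3 of the Card-36 comparison-model series (parts 1–2: `BalabanUVNodesN21GaussianMillsRatio`, `…GaussianSupDensityBound`).

WHAT THIS FILE IS.  The lens memo `ym-lens-BalabanUVNodes-nearmiss/LENS-nearmiss.md` v12.0 Card 36 kill-test KT-36b:
«unit variance normalisation — the `u_p` have `p`-dependent variances `σ_p²` (Hessian diagonal); CCK needs `E X_t² = 1`:
rescale per `p`, which turns the common threshold `θ` into `p`-dependent thresholds `θ∕σ_p` — the sup-form is lost unless
`σ_p` is `p`-uniform up to `1 + o(1)`».  In the INDEPENDENT comparison model the sup-form is NOT lost and no `1 + o(1)` is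
needed: for `X_i ~ N(0, v_i)` independent, `0 < v_min ≤ v_i ≤ v_max`, the law of `max_i X_i` under
`Measure.pi (fun i => gaussianReal 0 (v i))` has the tree's `T4ShellMeasure.DensityBound` with constant
`(√(v_max∕v_min)·√(2 log n) + 4)∕√v_min` (§4) — the heterogeneity costs only the RATIO `√(v_max∕v_min)` in front of the
logarithm.  Mechanism: `P(max ≤ z) = ∏_i Φ(z∕√v_i)`; its derivative `Σ_i φ(z∕√v_i)∕√v_i · ∏_{k≠i} Φ(z∕√v_k)` is bounded
through the UNIFORM Mills bound `φ(w) ≤ (max(w,0) + 4)(1 − Φ(w))` (§1, from part 1's Gordon inequality) and the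
«exactly one exceeds» inequality `Σ_i (1 − t_i)·∏_{k≠i} t_k ≤ 1` on `[0,1]^n` (§2), for `z ≤ √v_max·√(2 log n)`; beyond
that point by `n·φ(√(2 log n)) = 1∕√(2π)`.

HONEST FRAMING.  [textbook] probability, 0 def, 0 sorry; nothing of Bałaban's asserted.  Independence is the model's
assumption (correlated fibre variables = KT-36a∕CCK 2015 Thm 3, NOT in the tree); NE7c NOT PRINTED ∕ NOT proved; N21
NOT discharged; counts unmoved (typed 28∕28 · discharged 5∕27); count-neutral; one finite 𝕋⁴ at fixed ε — nothing about
ℝ⁴ ∕ OS ∕ mass gap ∕ Clay.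
-/

open MeasureTheory ProbabilityTheory Set Filter Topology Finset
open scoped ENNReal NNReal

namespace Summit.QuantumFields.YangMills.Theorems.N21GaussianSupDensityBoundHetero

open Summit.QuantumFields.YangMills.Theorems.N21GaussianMillsRatio
open Summit.QuantumFields.YangMills.Theorems.N21GaussianSupDensityBound (measurable_sup' setOf_sup'_le_eq_pi)

/-! ## §1 One coordinate `N(0, v)`: scaling to the standard normal, and the uniform Mills bound -/

/-- `N(0, v)` is the image of `N(0, 1)` under `x ↦ √v·x`. [textbook] -/
theorem gaussianReal_var_eq_map (v : ℝ≥0) :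
    gaussianReal 0 v = (gaussianReal 0 1).map (fun x => Real.sqrt v * x) := by
  have h := gaussianReal_map_const_mul (μ := (0 : ℝ)) (v := (1 : ℝ≥0)) (Real.sqrt v)
  rw [mul_zero, mul_one] at h
  have hv : NNReal.mk (Real.sqrt v ^ 2) (sq_nonneg _) = v :=
    NNReal.eq (by rw [NNReal.coe_mk, Real.sq_sqrt v.coe_nonneg])
  rw [hv] at h
  exact h.symm

/-- `N(0, v)((−∞, z]) = Φ(z∕√v)` for `v ≠ 0`. [textbook] -/
theorem gaussianReal_var_real_Iic {v : ℝ≥0} (hv : v ≠ 0) (z : ℝ) :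
    (gaussianReal 0 v).real (Iic z) = cdf (gaussianReal 0 1) (z / Real.sqrt v) := by
  have hσ : 0 < Real.sqrt v := Real.sqrt_pos.2 (by exact_mod_cast pos_iff_ne_zero.2 hv)
  have hpre : (fun x => Real.sqrt v * x) ⁻¹' Iic z = Iic (z / Real.sqrt v) := by
    ext x
    simp only [Set.mem_preimage, Set.mem_Iic]
    rw [le_div_iff₀ hσ, mul_comm]
  rw [gaussianReal_var_eq_map, measureReal_def, Measure.map_apply (measurable_const_mul _) measurableSet_Iic,
    cdf_eq_real, measureReal_def, hpre]

/-- **UNIFORM MILLS BOUND**: `φ(w) ≤ (max(w, 0) + 4)·(1 − Φ(w))` for every real `w` (part 1's bounds on `(−∞, 1]` and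
`[1, ∞)` merged). [textbook] -/
theorem gaussianPDFReal_le_posPart_add_four_mul_tail (w : ℝ) :
    gaussianPDFReal 0 1 w ≤ (max w 0 + 4) * (1 - cdf (gaussianReal 0 1) w) := by
  have htail := (one_sub_cdf_std_pos w).le
  have hmax : 0 ≤ max w 0 := le_max_right _ _
  rcases le_or_gt w 1 with hw | hw
  · have h := gaussianPDFReal_le_tail_of_le_one hw
    nlinarith
  · have h := gaussianPDFReal_le_tail_of_one_le hw.le
    have : w ≤ max w 0 := le_max_left _ _
    nlinarith

/-- `n·φ(√(2 log n)) = 1∕√(2π)` (`n ≥ 1`). [textbook] -/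
theorem nat_mul_gaussianPDFReal_sqrt_two_log {n : ℕ} (hn : 1 ≤ n) :
    (n : ℝ) * gaussianPDFReal 0 1 (Real.sqrt (2 * Real.log n)) = (Real.sqrt (2 * Real.pi))⁻¹ := by
  have hn0 : (0 : ℝ) < n := by exact_mod_cast hn
  have hlog : 0 ≤ Real.log n := Real.log_nonneg (by exact_mod_cast hn)
  rw [gaussianPDFReal_std, Real.sq_sqrt (by positivity)]
  have : Real.exp (-(2 * Real.log n) / 2) = (n : ℝ)⁻¹ := by
    rw [show -(2 * Real.log (n : ℝ)) / 2 = -Real.log n by ring, Real.exp_neg, Real.exp_log hn0]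
  rw [this]
  field_simp

/-! ## §2 «Exactly one exceeds»: `Σ_i (1 − t_i)·∏_{k≠i} t_k ≤ 1` on `[0, 1]^n` -/

/-- for `t ∈ [0,1]^s`: `Σ_{i∈s} (1 − t_i)·∏_{k∈s∖i} t_k + ∏_{i∈s} t_i ≤ 1` (the probabilities of «exactly one failure» and
«no failure» among independent events). [textbook] -/
theorem sum_one_sub_mul_prod_erase_add_prod_le_one {ι : Type*} [DecidableEq ι] (s : Finset ι) (t : ι → ℝ)
    (h0 : ∀ i ∈ s, 0 ≤ t i) (h1 : ∀ i ∈ s, t i ≤ 1) :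
    ∑ i ∈ s, (1 - t i) * ∏ k ∈ s.erase i, t k + ∏ i ∈ s, t i ≤ 1 := by
  induction s using Finset.induction_on with
  | empty => simp
  | @insert a s ha ih =>
    have h0s : ∀ i ∈ s, 0 ≤ t i := fun i hi => h0 i (mem_insert_of_mem hi)
    have h1s : ∀ i ∈ s, t i ≤ 1 := fun i hi => h1 i (mem_insert_of_mem hi)
    have hih := ih h0s h1s
    have ha0 : 0 ≤ t a := h0 a (mem_insert_self a s)
    have ha1 : t a ≤ 1 := h1 a (mem_insert_self a s)
    have hP : 0 ≤ ∏ i ∈ s, t i := prod_nonneg h0s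
    have hS : 0 ≤ ∑ i ∈ s, (1 - t i) * ∏ k ∈ s.erase i, t k :=
      sum_nonneg fun i hi => mul_nonneg (sub_nonneg.2 (h1s i hi)) (prod_nonneg fun k hk => h0s k (mem_of_mem_erase hk))
    -- the sum over `insert a s`: the `a`-term has the product over `s`; the `i ∈ s` terms pick up the factor `t a`
    have herase_a : (insert a s).erase a = s := by
      rw [erase_insert ha]
    have hterm : ∀ i ∈ s, (1 - t i) * ∏ k ∈ (insert a s).erase i, t k = t a * ((1 - t i) * ∏ k ∈ s.erase i, t k) := by
      intro i hi
      have hia : i ≠ a := fun h => ha (h ▸ hi)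
      rw [erase_insert_of_ne hia.symm, prod_insert (fun h => ha (mem_of_mem_erase h))]
      ring
    rw [sum_insert ha, prod_insert ha, herase_a, sum_congr rfl hterm, ← mul_sum]
    nlinarith

/-- «EXACTLY ONE EXCEEDS»: `Σ_{i∈s} (1 − t_i)·∏_{k∈s∖i} t_k ≤ 1` for `t ∈ [0,1]^s`. [textbook] -/
theorem sum_one_sub_mul_prod_erase_le_one {ι : Type*} [DecidableEq ι] (s : Finset ι) (t : ι → ℝ)
    (h0 : ∀ i ∈ s, 0 ≤ t i) (h1 : ∀ i ∈ s, t i ≤ 1) :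
    ∑ i ∈ s, (1 - t i) * ∏ k ∈ s.erase i, t k ≤ 1 := by
  have h := sum_one_sub_mul_prod_erase_add_prod_le_one s t h0 h1
  have hP : 0 ≤ ∏ i ∈ s, t i := prod_nonneg h0
  linarith

/-! ## §3 The pointwise bound on the density of the maximum -/

section Hetero

variable {n : ℕ} [NeZero n] {v : Fin n → ℝ≥0} {vmin vmax : ℝ}

omit [NeZero n] in
/-- the standard deviations are squeezed between `√v_min` and `√v_max`. [textbook] -/
theorem sqrt_var_bounds (hvmin : 0 < vmin) (hle : ∀ i, vmin ≤ (v i : ℝ)) (hge : ∀ i, (v i : ℝ) ≤ vmax) (i : Fin n) :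
    0 < Real.sqrt (v i) ∧ Real.sqrt vmin ≤ Real.sqrt (v i) ∧ Real.sqrt (v i) ≤ Real.sqrt vmax :=
  ⟨Real.sqrt_pos.2 (hvmin.trans_le (hle i)), Real.sqrt_le_sqrt (hle i), Real.sqrt_le_sqrt (hge i)⟩

/-- **THE DENSITY OF THE MAXIMUM OF INDEPENDENT `N(0, v_i)`, `v_min ≤ v_i ≤ v_max`, IS AT MOST
`(√(v_max∕v_min)·√(2 log n) + 4)∕√v_min`** pointwise: the derivative `Σ_i (∏_{k≠i} Φ(z∕√v_k))·(φ(z∕√v_i)·(1∕√v_i))` of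
`z ↦ ∏_i Φ(z∕√v_i)` obeys this bound for every `z`. [textbook] -/
theorem maxDensityHetero_le (hvmin : 0 < vmin) (hle : ∀ i, vmin ≤ (v i : ℝ)) (hge : ∀ i, (v i : ℝ) ≤ vmax) (z : ℝ) :
    ∑ i, (∏ k ∈ univ.erase i, cdf (gaussianReal 0 1) (z / Real.sqrt (v k)))
        * (gaussianPDFReal 0 1 (z / Real.sqrt (v i)) * (1 / Real.sqrt (v i)))
      ≤ (Real.sqrt (vmax / vmin) * Real.sqrt (2 * Real.log n) + 4) / Real.sqrt vmin := by
  have hn : 1 ≤ n := NeZero.one_le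
  have hn0 : (0 : ℝ) < n := by exact_mod_cast hn
  set smin := Real.sqrt vmin with hsmin
  set smax := Real.sqrt vmax with hsmax
  set L := Real.sqrt (2 * Real.log n) with hL
  set w₁ := Real.sqrt (vmax / vmin) * L with hw₁
  have hsmin0 : 0 < smin := Real.sqrt_pos.2 hvmin
  have hvmax : vmin ≤ vmax := (hle 0).trans (hge 0)
  have hsmax0 : 0 < smax := Real.sqrt_pos.2 (hvmin.trans_le hvmax)
  have hL0 : 0 ≤ L := Real.sqrt_nonneg _
  have hratio : Real.sqrt (vmax / vmin) = smax / smin := by rw [hsmax, hsmin, Real.sqrt_div' _ hvmin.le]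
  have hw₁0 : 0 ≤ w₁ := by positivity
  have hσ := sqrt_var_bounds hvmin hle hge
  -- abbreviations per coordinate
  have hΦ0 : ∀ i, 0 ≤ cdf (gaussianReal 0 1) (z / Real.sqrt (v i)) := fun i => cdf_nonneg _ _
  have hΦ1 : ∀ i, cdf (gaussianReal 0 1) (z / Real.sqrt (v i)) ≤ 1 := fun i => cdf_le_one _ _
  have hprod1 : ∀ i, ∏ k ∈ univ.erase i, cdf (gaussianReal 0 1) (z / Real.sqrt (v k)) ≤ 1 := fun i =>
    prod_le_one (fun k _ => hΦ0 k) (fun k _ => hΦ1 k)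
  have hprod0 : ∀ i, 0 ≤ ∏ k ∈ univ.erase i, cdf (gaussianReal 0 1) (z / Real.sqrt (v k)) := fun i =>
    prod_nonneg fun k _ => hΦ0 k
  rcases le_or_gt z (smax * L) with hz | hz
  · -- z ≤ √v_max·√(2 log n): uniform Mills bound + «exactly one exceeds»
    have hC : ∀ i, gaussianPDFReal 0 1 (z / Real.sqrt (v i)) * (1 / Real.sqrt (v i))
        ≤ ((w₁ + 4) / smin) * (1 - cdf (gaussianReal 0 1) (z / Real.sqrt (v i))) := by
      intro i
      obtain ⟨hσ0, hσ1, hσ2⟩ := hσ i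
      have hm := gaussianPDFReal_le_posPart_add_four_mul_tail (z / Real.sqrt (v i))
      have htail := (one_sub_cdf_std_pos (z / Real.sqrt (v i))).le
      -- max (z/σ_i) 0 ≤ w₁
      have hmaxle : max (z / Real.sqrt (v i)) 0 ≤ w₁ := by
        refine max_le ?_ hw₁0
        rcases le_or_gt z 0 with hz0 | hz0
        · exact (div_nonpos_of_nonpos_of_nonneg hz0 hσ0.le).trans hw₁0
        · calc z / Real.sqrt (v i) ≤ z / smin := div_le_div_of_nonneg_left hz0.le hsmin0 hσ1
            _ ≤ smax * L / smin := div_le_div_of_nonneg_right hz hsmin0.le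
            _ = w₁ := by rw [hw₁, hratio]; ring
      have hinv : 1 / Real.sqrt (v i) ≤ 1 / smin := one_div_le_one_div_of_le hsmin0 hσ1
      calc gaussianPDFReal 0 1 (z / Real.sqrt (v i)) * (1 / Real.sqrt (v i))
          ≤ ((max (z / Real.sqrt (v i)) 0 + 4) * (1 - cdf (gaussianReal 0 1) (z / Real.sqrt (v i)))) * (1 / smin) :=
            mul_le_mul hm hinv (by positivity) (mul_nonneg (by positivity) htail)
        _ ≤ ((w₁ + 4) * (1 - cdf (gaussianReal 0 1) (z / Real.sqrt (v i)))) * (1 / smin) := by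
            gcongr
        _ = ((w₁ + 4) / smin) * (1 - cdf (gaussianReal 0 1) (z / Real.sqrt (v i))) := by ring
    have hone := sum_one_sub_mul_prod_erase_le_one (univ : Finset (Fin n))
      (fun k => cdf (gaussianReal 0 1) (z / Real.sqrt (v k))) (fun k _ => hΦ0 k) (fun k _ => hΦ1 k)
    calc ∑ i, (∏ k ∈ univ.erase i, cdf (gaussianReal 0 1) (z / Real.sqrt (v k)))
            * (gaussianPDFReal 0 1 (z / Real.sqrt (v i)) * (1 / Real.sqrt (v i)))
        ≤ ∑ i, (∏ k ∈ univ.erase i, cdf (gaussianReal 0 1) (z / Real.sqrt (v k)))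
            * (((w₁ + 4) / smin) * (1 - cdf (gaussianReal 0 1) (z / Real.sqrt (v i)))) :=
          sum_le_sum fun i _ => mul_le_mul_of_nonneg_left (hC i) (hprod0 i)
      _ = ((w₁ + 4) / smin) * ∑ i, (1 - cdf (gaussianReal 0 1) (z / Real.sqrt (v i)))
            * ∏ k ∈ univ.erase i, cdf (gaussianReal 0 1) (z / Real.sqrt (v k)) := by
          rw [mul_sum]
          exact sum_congr rfl fun i _ => by ring
      _ ≤ ((w₁ + 4) / smin) * 1 := mul_le_mul_of_nonneg_left hone (by positivity)
      _ = (Real.sqrt (vmax / vmin) * L + 4) / smin := by rw [mul_one, hw₁]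
  · -- z > √v_max·√(2 log n) ≥ 0: every φ(z/σ_i) ≤ φ(√(2 log n)) = 1/(n√(2π))
    have hz0 : 0 ≤ z := (mul_nonneg hsmax0.le hL0).trans hz.le
    have hφ : ∀ i, gaussianPDFReal 0 1 (z / Real.sqrt (v i)) ≤ gaussianPDFReal 0 1 L := by
      intro i
      obtain ⟨hσ0, hσ1, hσ2⟩ := hσ i
      refine gaussianPDFReal_std_antitone hL0 ?_
      -- L ≤ z/σ_max ≤ z/σ_i
      calc L ≤ z / smax := by rw [le_div_iff₀ hsmax0, mul_comm]; exact hz.le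
        _ ≤ z / Real.sqrt (v i) := div_le_div_of_nonneg_left hz0 hσ0 hσ2
    have hterm : ∀ i, (∏ k ∈ univ.erase i, cdf (gaussianReal 0 1) (z / Real.sqrt (v k)))
        * (gaussianPDFReal 0 1 (z / Real.sqrt (v i)) * (1 / Real.sqrt (v i))) ≤ gaussianPDFReal 0 1 L * (1 / smin) := by
      intro i
      obtain ⟨hσ0, hσ1, hσ2⟩ := hσ i
      have hinv : 1 / Real.sqrt (v i) ≤ 1 / smin := one_div_le_one_div_of_le hsmin0 hσ1
      calc (∏ k ∈ univ.erase i, cdf (gaussianReal 0 1) (z / Real.sqrt (v k)))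
            * (gaussianPDFReal 0 1 (z / Real.sqrt (v i)) * (1 / Real.sqrt (v i)))
          ≤ 1 * (gaussianPDFReal 0 1 L * (1 / smin)) :=
            mul_le_mul (hprod1 i) (mul_le_mul (hφ i) hinv (by positivity) (gaussianPDFReal_nonneg _ _ _))
              (mul_nonneg (gaussianPDFReal_nonneg _ _ _) (by positivity)) zero_le_one
        _ = gaussianPDFReal 0 1 L * (1 / smin) := one_mul _
    have hval := nat_mul_gaussianPDFReal_sqrt_two_log hn
    calc ∑ i, (∏ k ∈ univ.erase i, cdf (gaussianReal 0 1) (z / Real.sqrt (v k)))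
            * (gaussianPDFReal 0 1 (z / Real.sqrt (v i)) * (1 / Real.sqrt (v i)))
        ≤ ∑ _i : Fin n, gaussianPDFReal 0 1 L * (1 / smin) := sum_le_sum fun i _ => hterm i
      _ = (n : ℝ) * gaussianPDFReal 0 1 L * (1 / smin) := by
          rw [sum_const, card_univ, Fintype.card_fin, nsmul_eq_mul]; ring
      _ = (Real.sqrt (2 * Real.pi))⁻¹ / smin := by rw [hL, hval]; ring
      _ ≤ 1 / smin := div_le_div_of_nonneg_right inv_sqrt_two_pi_le_one hsmin0.le
      _ ≤ (Real.sqrt (vmax / vmin) * L + 4) / smin := by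
          refine div_le_div_of_nonneg_right ?_ hsmin0.le
          nlinarith [hw₁0]

/-! ## §4 The law of the maximum under `Measure.pi (fun i => gaussianReal 0 (v i))` -/

/-- **`P(max ≤ z) = ∏_i Φ(z∕√v_i)`** for independent `N(0, v_i)` (`v_i ≠ 0`). [textbook] -/
theorem pi_gaussianReal_var_real_sup'_le (hv : ∀ i, v i ≠ 0) (z : ℝ) :
    (Measure.pi fun i : Fin n => gaussianReal 0 (v i)).real
        {ω : Fin n → ℝ | Finset.univ.sup' Finset.univ_nonempty ω ≤ z}
      = ∏ i, cdf (gaussianReal 0 1) (z / Real.sqrt (v i)) := by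
  rw [setOf_sup'_le_eq_pi, measureReal_def, Measure.pi_pi, ENNReal.toReal_prod]
  exact prod_congr rfl fun i _ => by rw [← measureReal_def, gaussianReal_var_real_Iic (hv i)]

/-- `P(a < max ≤ b) = ∏Φ(b∕√v_i) − ∏Φ(a∕√v_i)` (`a ≤ b`). [textbook] -/
theorem pi_gaussianReal_var_real_sup'_mem_Ioc (hv : ∀ i, v i ≠ 0) {a b : ℝ} (hab : a ≤ b) :
    (Measure.pi fun i : Fin n => gaussianReal 0 (v i)).real
        {ω : Fin n → ℝ | a < Finset.univ.sup' Finset.univ_nonempty ω ∧ Finset.univ.sup' Finset.univ_nonempty ω ≤ b}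
      = ∏ i, cdf (gaussianReal 0 1) (b / Real.sqrt (v i)) - ∏ i, cdf (gaussianReal 0 1) (a / Real.sqrt (v i)) := by
  have hset : {ω : Fin n → ℝ | a < Finset.univ.sup' Finset.univ_nonempty ω ∧ Finset.univ.sup' Finset.univ_nonempty ω ≤ b}
      = {ω : Fin n → ℝ | Finset.univ.sup' Finset.univ_nonempty ω ≤ b}
        \ {ω : Fin n → ℝ | Finset.univ.sup' Finset.univ_nonempty ω ≤ a} := by
    ext ω
    simp only [mem_setOf_eq, Set.mem_sdiff, not_le]
    tauto
  have hsub : {ω : Fin n → ℝ | Finset.univ.sup' Finset.univ_nonempty ω ≤ a}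
      ⊆ {ω : Fin n → ℝ | Finset.univ.sup' Finset.univ_nonempty ω ≤ b} := fun ω hω => le_trans hω hab
  have hmeas : MeasurableSet {ω : Fin n → ℝ | Finset.univ.sup' Finset.univ_nonempty ω ≤ a} :=
    measurable_sup' measurableSet_Iic
  rw [hset, measureReal_sdiff hsub hmeas, pi_gaussianReal_var_real_sup'_le hv, pi_gaussianReal_var_real_sup'_le hv]

/-- the distribution function `z ↦ ∏_i Φ(z∕√v_i)` of the maximum is Lipschitz with the constant of §3 (mean value theorem,
part 1's `Φ′ = φ`, `HasDerivAt.fun_finsetProd`). [textbook] -/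
theorem prod_cdf_sub_le (hvmin : 0 < vmin) (hle : ∀ i, vmin ≤ (v i : ℝ)) (hge : ∀ i, (v i : ℝ) ≤ vmax)
    {a b : ℝ} (hab : a ≤ b) :
    ∏ i, cdf (gaussianReal 0 1) (b / Real.sqrt (v i)) - ∏ i, cdf (gaussianReal 0 1) (a / Real.sqrt (v i))
      ≤ (Real.sqrt (vmax / vmin) * Real.sqrt (2 * Real.log n) + 4) / Real.sqrt vmin * (b - a) := by
  have hderiv : ∀ x, HasDerivAt (fun z => ∏ i, cdf (gaussianReal 0 1) (z / Real.sqrt (v i)))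
      (∑ i, (∏ k ∈ univ.erase i, cdf (gaussianReal 0 1) (x / Real.sqrt (v k)))
        • (gaussianPDFReal 0 1 (x / Real.sqrt (v i)) * (1 / Real.sqrt (v i)))) x := by
    intro x
    refine HasDerivAt.fun_finsetProd fun i _ => ?_
    have h1 : HasDerivAt (fun z : ℝ => z / Real.sqrt (v i)) (1 / Real.sqrt (v i)) x := (hasDerivAt_id' x).div_const _
    exact (hasDerivAt_cdf_std (x / Real.sqrt (v i))).comp x h1
  have hdiff : Differentiable ℝ fun z => ∏ i, cdf (gaussianReal 0 1) (z / Real.sqrt (v i)) :=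
    fun x => (hderiv x).differentiableAt
  have hbound : ∀ x, deriv (fun z => ∏ i, cdf (gaussianReal 0 1) (z / Real.sqrt (v i))) x
      ≤ (Real.sqrt (vmax / vmin) * Real.sqrt (2 * Real.log n) + 4) / Real.sqrt vmin := fun x => by
    rw [(hderiv x).deriv]
    simp only [smul_eq_mul]
    exact maxDensityHetero_le hvmin hle hge x
  exact image_sub_le_mul_sub_of_deriv_le hdiff hbound hab

/-- **`DensityBound` FOR THE LAW OF THE MAXIMUM, HETEROGENEOUS VARIANCES** (the tree's `T4ShellMeasure.DensityBound`
currency): independent `X_i ~ N(0, v_i)`, `0 < v_min ≤ v_i ≤ v_max` ⇒ the law of `max_i X_i` gives every `[a, b]` mass at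
most `((√(v_max∕v_min)·√(2 log n) + 4)∕√v_min)·(b − a)` — KT-36b in the independent model: the ratio of the extreme
standard deviations multiplies the logarithm, nothing else changes. [textbook] -/
theorem densityBound_map_sup'_pi_gaussianReal_var (hvmin : 0 < vmin) (hle : ∀ i, vmin ≤ (v i : ℝ))
    (hge : ∀ i, (v i : ℝ) ≤ vmax) :
    Literature.MathematicalPhysics.QuantumFieldTheory.Balaban1983to89.T4ShellMeasure.DensityBound
      ((Measure.pi fun i : Fin n => gaussianReal 0 (v i)).map
        fun ω : Fin n → ℝ => Finset.univ.sup' Finset.univ_nonempty ω)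
      ((Real.sqrt (vmax / vmin) * Real.sqrt (2 * Real.log n) + 4) / Real.sqrt vmin) := by
  have hv : ∀ i, v i ≠ 0 := fun i h => by
    have := hle i
    rw [h, NNReal.coe_zero] at this
    exact absurd this (not_le.2 hvmin)
  intro a b hab
  set μ := (Measure.pi fun i : Fin n => gaussianReal 0 (v i)) with hμ
  set S := (Real.sqrt (vmax / vmin) * Real.sqrt (2 * Real.log n) + 4) / Real.sqrt vmin with hS
  have hS1 : 0 < S := by
    have : 0 < Real.sqrt vmin := Real.sqrt_pos.2 hvmin
    positivity
  rw [Measure.map_apply measurable_sup' measurableSet_Icc]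
  refine ENNReal.le_of_forall_pos_le_add fun η hη _ => ?_
  have hη' : (0 : ℝ) < η := hη
  set δ : ℝ := (η : ℝ) / S with hδ
  have hδ0 : 0 < δ := div_pos hη' hS1
  have hsub : (fun ω : Fin n → ℝ => Finset.univ.sup' Finset.univ_nonempty ω) ⁻¹' Icc a b
      ⊆ {ω : Fin n → ℝ | a - δ < Finset.univ.sup' Finset.univ_nonempty ω ∧ Finset.univ.sup' Finset.univ_nonempty ω ≤ b} := by
    intro ω hω
    simp only [Set.mem_preimage, Set.mem_Icc] at hω
    exact ⟨by linarith [hω.1], hω.2⟩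
  have hSδ : S * (b - (a - δ)) = S * (b - a) + η := by
    rw [hδ]
    field_simp
    ring
  calc μ ((fun ω : Fin n → ℝ => Finset.univ.sup' Finset.univ_nonempty ω) ⁻¹' Icc a b)
      ≤ μ {ω : Fin n → ℝ | a - δ < Finset.univ.sup' Finset.univ_nonempty ω ∧ Finset.univ.sup' Finset.univ_nonempty ω ≤ b} :=
        measure_mono hsub
    _ = ENNReal.ofReal (∏ i, cdf (gaussianReal 0 1) (b / Real.sqrt (v i))
          - ∏ i, cdf (gaussianReal 0 1) ((a - δ) / Real.sqrt (v i))) := by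
        rw [← pi_gaussianReal_var_real_sup'_mem_Ioc hv (by linarith), measureReal_def,
          ENNReal.ofReal_toReal (measure_ne_top _ _)]
    _ ≤ ENNReal.ofReal (S * (b - (a - δ))) := ENNReal.ofReal_le_ofReal (prod_cdf_sub_le hvmin hle hge (by linarith))
    _ = ENNReal.ofReal (S * (b - a)) + ENNReal.ofReal (η : ℝ) := by
        rw [hSδ, ENNReal.ofReal_add (by nlinarith) hη'.le]
    _ = ENNReal.ofReal (S * (b - a)) + η := by rw [ENNReal.ofReal_coe_nnreal]

/-- **(M1) FOR THE HETEROGENEOUS GAUSSIAN-MAX SLOT VARIABLE**: `SlotAntiConcentration μ max θ ρ (S·θ)` with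
`S = (√(v_max∕v_min)·√(2 log n) + 4)∕√v_min`, `θ, ρ ≥ 0`. [textbook] -/
theorem slotAntiConcentration_sup'_pi_gaussianReal_var (hvmin : 0 < vmin) (hle : ∀ i, vmin ≤ (v i : ℝ))
    (hge : ∀ i, (v i : ℝ) ≤ vmax) {θ ρ : ℝ} (hθ : 0 ≤ θ) (hρ : 0 ≤ ρ) :
    Literature.MathematicalPhysics.QuantumFieldTheory.Balaban1983to89.T4ShellMeasure.SlotAntiConcentration
      (Measure.pi fun i : Fin n => gaussianReal 0 (v i))
      (fun ω : Fin n → ℝ => Finset.univ.sup' Finset.univ_nonempty ω) θ ρ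
      ((Real.sqrt (vmax / vmin) * Real.sqrt (2 * Real.log n) + 4) / Real.sqrt vmin * θ) := by
  unfold Literature.MathematicalPhysics.QuantumFieldTheory.Balaban1983to89.T4ShellMeasure.SlotAntiConcentration
  have hsub : {ω : Fin n → ℝ | θ * (1 - ρ) ≤ Finset.univ.sup' Finset.univ_nonempty ω ∧ Finset.univ.sup' Finset.univ_nonempty ω < θ}
      ⊆ (fun ω : Fin n → ℝ => Finset.univ.sup' Finset.univ_nonempty ω) ⁻¹' Icc (θ * (1 - ρ)) θ := by
    intro ω hω
    simp only [mem_setOf_eq, Set.mem_preimage, Set.mem_Icc] at hω ⊢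
    exact ⟨hω.1, hω.2.le⟩
  rw [measure_univ, mul_one]
  refine (measure_mono hsub).trans ?_
  rw [← Measure.map_apply measurable_sup' measurableSet_Icc]
  have h := densityBound_map_sup'_pi_gaussianReal_var hvmin hle hge (θ * (1 - ρ)) θ (by nlinarith)
  refine h.trans (le_of_eq ?_)
  congr 1
  ring

end Hetero

end Summit.QuantumFields.YangMills.Theorems.N21GaussianSupDensityBoundHetero
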